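import Literature.AlgebraicGeometry.HodgeTheory.HodgeGenericQbarDescentFiniteMonodromyInputs
import HarnessLib

/-!
# Route `LinearSystemTorelli` — crux `MiddleDivisorSupportFourfold` (stmt-HodgeConjecture-2409), line
`IdeatorFiveSketch`, stub B: the DOMINANT `ℚ̄`-envelope of a finite-monodromy class at a `ℚ̄`-generic point

Helper file for the crux item stmt-HodgeConjecture-2409 (`--supports`; it closes nothing): it proves
the registered stub `stub_dominantEnvelopeOfFiniteMonodromy` of the line's skeleton
(`Cruxes/MiddleDivisorSupportFourfold/Lines/IdeatorFiveSketch.lean`, lead c3) — Voisin's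
finite-monodromy mechanism (*Hodge loci and absolute Hodge classes*, §3, proof of Prop. 0.7 =
arXiv math/0605766 Prop. 1.7; Charles–Schnell, *Notes on absolute Hodge classes*, Thm. 11.3.19) with
its OUTPUT recorded as an ENVELOPE `α = ι^* β` (rather than consumed by the Hodge conjecture over `ℚ̄`
as in the tree's named fact `voisin2007_algebraic_of_finite_monodromyOrbit_of_qbar`), together with
the DOMINANCE of `ι` onto the `ℚ̄`-model when the base point lies over the generic point of the base:

> for `σ : ℚ̄ →+* ℂ`, a `ℚ̄`-morphism `f₀ : 𝒳₀ ⟶ S₀` of quasi-projective `ℚ̄`-schemes with `S₀`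
> smooth irreducible and smooth projective complexification, a complex point `s` over the GENERIC
> point of `S₀` and a rational `(p,p)` class `α` on `𝒳_s` with finite monodromy orbit, there are a
> `ℚ̄`-scheme `X̄₀` with smooth projective complexification, a `ℂ`-morphism
> `ι : 𝒳_s ⟶ X̄₀ ⊗_σ ℂ` whose composite with the projection to `X̄₀` has DENSE image, and a
> rational `(p,p)` class `β` on `X̄₀ ⊗_σ ℂ` with `ι^* β = α` — granted Riemann's existence
> theorem with `ℚ̄`-descent of finite étale covers (named fact
> `FundamentalGroup.riemannExistence_qbarDescent_of_finiteIndex`) and Deligne's global invariant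
> cycle theorem (named fact `deligne_globalInvariantCycles`), the two antecedents of the stub.

Why the lead wants dominance: the crux asks for DIVISOR support of `α`, and the pull-back of a class
dying off the preimage of a proper `ℚ̄`-closed `Z₀ ⊊ X̄₀` along a map DOMINANT onto `X̄₀` dies off a
proper closed subset of the integral fibre (`linearSystemTorelli_middleDivisorSupportFourfold_of_dominantQbarEnvelope`,
p117963) — no cycle class / Fulton Cor. 19.2 (b) is then needed for the glue.

Steps 1–6 are those of `voisin2007_algebraic_of_finite_monodromyOrbit_of_qbar_of_classical_inputs`
(`HodgeGenericQbarDescentProofs.lean`; finite orbit ⟹ finite-index stabiliser; the finite étale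
cover `S₀' → S₀` over `ℚ̄`; invariance on the cover and the continuous global section; the smooth
projective compactification `i₀ : 𝒳₀ ×_{S₀} S₀' ↪ X̄₀` over `ℚ̄`, here kept EXPLICIT as the base
change of a `ℚ̄`-open-immersion — Hironaka over `ℚ̄` is the tree's theorem
`exists_isSmoothProjective_isOpenImmersion`; the Hodge lift of the invariant section, with the
polarisability supplied by the tree's theorem `smoothProjective_hodgeStructure_isPolarizable_holds`).
Step 7 (new) is the dominance: `𝒳_s ≅ 𝒳'_{s'}` maps ONTO the fibre of `f₀' : 𝒳₀ ×_{S₀} S₀' → S₀'`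
over the image `η'` of `s'` (two cartesian squares: the fibre square and the `σ`-base-change square,
`Scheme.exists_preimage_of_isPullback`); `η'` is THE generic point of `S₀'` (it lies over the generic
point of `S₀`, and `S₀' → S₀` is finite, with discrete fibres —
`closure_singleton_eq_univ_of_locallyQuasiFinite`); the generic fibre of the flat `f₀'` is dense
(flat morphisms are generalizing — `dense_preimage_singleton_of_flat`); and `i₀` has open, hence
dense, image in the irreducible `X̄₀`.

* `closure_singleton_eq_univ_of_locallyQuasiFinite`, `dense_preimage_singleton_of_flat`,
  `range_fiberι_left_base` — the three scheme-theoretic lemmas of Step 7;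
* `stub_dominantEnvelopeOfFiniteMonodromy` — the registered stub B, PROVED (standard axioms).
-/

-- every declaration of this problem lives in `Summit.HodgeConjecture.HodgeConjecture.…`
set_option linter.dupNamespace false

noncomputable section

namespace Summit.HodgeConjecture.HodgeConjecture.Theorems

open CategoryTheory CategoryTheory.Limits AlgebraicGeometry
open _root_.Topology
open Literature.AlgebraicGeometry Literature.AlgebraicGeometry.Motives
open Literature.AlgebraicGeometry.HodgeTheory
open Literature.AlgebraicTopology.SingularHomology

/-! ### Generic points: under a finite morphism onto an irreducible scheme, a point over the generic
point is the generic point -/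

/-- For a locally quasi-finite morphism `g : T ⟶ S` of schemes with `T` irreducible, a point `t ∈ T`
whose image is a generic point of `S` (its closure is everything) is the generic point of `T`: the
generic point `ξ` of `T` specialises to `t`, so `g ξ` specialises to `g t`, which is generic, hence
`g ξ = g t`; the fibre of `g` over that point is discrete, so `ξ = t`. [folklore] -/
theorem closure_singleton_eq_univ_of_locallyQuasiFinite {T S : Scheme} (g : T ⟶ S)
    [LocallyQuasiFinite g] [IrreducibleSpace T] {t : T}
    (ht : closure {g.base t} = (Set.univ : Set S)) : closure {t} = (Set.univ : Set T) := by
  have hξt : genericPoint T ⤳ t := genericPoint_specializes t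
  have h1 : g.base (genericPoint T) ⤳ g.base t := hξt.map g.base.hom.continuous
  have h2 : g.base t ⤳ g.base (genericPoint T) := by
    rw [specializes_iff_mem_closure, ht]
    exact Set.mem_univ _
  have heq : g.base (genericPoint T) = g.base t := (h1.antisymm h2).eq
  have hdisc := g.isDiscrete_preimage_singleton (g.base t)
  have hξ : genericPoint T = t :=
    hdisc.eq_of_specializes hξt (Set.mem_singleton_iff.2 heq) (Set.mem_singleton _)
  rw [← hξ]
  exact genericPoint_closure T

/-! ### Flat morphisms: the fibre over a generic point is dense -/

/-- For a flat morphism `f : X ⟶ S` of schemes and a point `η ∈ S` whose closure is everything, the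
fibre `f⁻¹{η}` is dense in `X`: flat morphisms are generalizing (`Flat.generalizingMap`), so every
`x ∈ X` has a generization `x'` with `f x' = η`. [cite: StacksProject, Tag 03HV] -/
theorem dense_preimage_singleton_of_flat {X S : Scheme} (f : X ⟶ S) [Flat f] {η : S}
    (hη : closure {η} = (Set.univ : Set S)) : Dense (f.base ⁻¹' {η}) := by
  intro x
  have hgen : GeneralizingMap f.base := Flat.generalizingMap f
  have hsp : η ⤳ f.base x := by
    rw [specializes_iff_mem_closure, hη]
    exact Set.mem_univ _
  obtain ⟨x', hx', hx'η⟩ := hgen hsp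
  exact closure_mono (Set.singleton_subset_iff.2 (show x' ∈ f.base ⁻¹' {η} from hx'η))
    (specializes_iff_mem_closure.1 hx')


/-! ### The range of the fibre inclusion -/

/-- The closed-fibre inclusion `𝒳_s ⟶ 𝒳` of a morphism of `ℂ`-schemes `f : 𝒳 ⟶ S` has range the
set-theoretic fibre `f⁻¹{s}` (`Scheme.Pullback.range_fst`; `Spec ℂ` is a point). [folklore] -/
theorem range_fiberι_left_base {𝒳 S : SchemeOver ℂ} (f : 𝒳 ⟶ S) (s : ComplexPoints S) :
    Set.range (fiberι f s).left.base = f.left.base ⁻¹' {s.pt} := by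
  haveI : Subsingleton ((Motives.specOver ℂ ℂ).left : Type) :=
    inferInstanceAs (Subsingleton (PrimeSpectrum ℂ))
  rw [Motives.fiberι_left]
  erw [Scheme.Pullback.range_fst]
  congr 1
  ext x
  simp only [Set.mem_range, Set.mem_singleton_iff]
  constructor
  · rintro ⟨y, rfl⟩
    rw [Subsingleton.elim y (IsLocalRing.closedPoint ℂ)]
    rfl
  · rintro rfl
    exact ⟨IsLocalRing.closedPoint ℂ, rfl⟩

/-! ### Stub B: the dominant `ℚ̄`-envelope of a finite-monodromy class at a `ℚ̄`-generic point -/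

/-- **Stub B of line `IdeatorFiveSketch` (crux stmt-HodgeConjecture-2409): the DOMINANT
`ℚ̄`-envelope of a finite-monodromy class at a `ℚ̄`-generic point** — Voisin, *Hodge loci and
absolute Hodge classes*, §3, proof of Prop. 0.7 (arXiv math/0605766 Prop. 1.7, p. 7): *"As
monodromy acts in a finite way on the set of Hodge classes …, there is an étale cover `S''` of the
smooth part of `S'`, also defined over `ℚ̄`, on which this monodromy action becomes trivial. Thus we
have by base change a family `π'' : 𝒳_{S''} → S''`, together with a global section `α̃` of
`R^{2k}π''_*ℚ`, whose restriction to `X_0` is equal to `α`. The global invariant cycle theorem now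
says that there exists a Hodge class `β` on a smooth compactification `𝒳̄_{S''}`, which we may assume
defined over `ℚ̄`, restricting to `α`"* = Charles–Schnell, *Notes on absolute Hodge classes*,
Thm. 11.3.19 (proof), with the OUTPUT recorded as an envelope `α = ι^* β` rather than consumed by
the Hodge conjecture over `ℚ̄`, and with one piece of extra information: when `s` lies over the
GENERIC point of `S₀`, the envelope map `ι : 𝒳_s ⟶ 𝒳̄₀ ⊗_σ ℂ` composed with the projection to the
`ℚ̄`-scheme `𝒳̄₀` has DENSE image — `𝒳_s ≅ 𝒳'_{s'}` maps ONTO the fibre of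
`𝒳₀ ×_{S₀} S₀' → S₀'` over the image `η'` of `s'` (a cartesian square), `η'` is the generic point of
`S₀'` (it lies over the generic point of `S₀` and `S₀' → S₀` is finite, with discrete fibres), that
fibre is dense in `𝒳₀ ×_{S₀} S₀'` (flat morphisms are generalizing), and `𝒳₀ ×_{S₀} S₀'` is an open
dense subscheme of the irreducible `𝒳̄₀` (Hironaka over `ℚ̄`, PROVED in the tree:
`exists_isSmoothProjective_isOpenImmersion`).
Inputs (antecedents, both NAMED FACTS of the tree): Riemann's existence theorem with descent of finite
étale covers to `ℚ̄` (SGA1 XII Thm. 5.1, XIII Prop. 4.6: `FundamentalGroup.riemannExistence_qbarDescent_of_finiteIndex`)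
and Deligne's global invariant cycle theorem (`deligne_globalInvariantCycles`, Hodge II Thm. 4.1.1);
the polarisability of the Hodge structures of smooth projective varieties is the tree's THEOREM
`smoothProjective_hodgeStructure_isPolarizable_holds`. Steps 1–5 are those of
`voisin2007_algebraic_of_finite_monodromyOrbit_of_qbar_of_classical_inputs` (HodgeGenericQbarDescentProofs).
[cite: Voisin2007HodgeLoci, §3, proof of Prop. 0.7 (arXiv math/0605766 Prop. 1.7, p. 7)]
[cite: CharlesSchnell2014Notes, Thm. 11.3.19 (proof)] [cite: SGA1, Exp. XII Thm. 5.1 and Exp. XIII Prop. 4.6]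
[cite: DeligneHodgeII1971, Théorème 4.1.1] [cite: Hironaka1964, Main Theorem I]
[cite: StacksProject, Tag 03HV] -/
theorem stub_dominantEnvelopeOfFiniteMonodromy :
    Literature.AlgebraicGeometry.FundamentalGroup.riemannExistence_qbarDescent_of_finiteIndex →
    deligne_globalInvariantCycles →
    ∀ (σ : AlgebraicClosure ℚ →+* ℂ) ⦃𝒳₀ S₀ : SchemeOver (AlgebraicClosure ℚ)⦄ (f₀ : 𝒳₀ ⟶ S₀)
      (n p : ℕ), IsQuasiProjectiveOver 𝒳₀ → IsQuasiProjectiveOver S₀ → IrreducibleSpace S₀.left →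
      AlgebraicGeometry.Smooth S₀.hom → IsSmoothProjectiveFamily ((baseChangeHom σ).map f₀) n →
      ∀ (s : ComplexPoints ((baseChangeHom σ).obj S₀)),
        closure {(baseChangeHomFst σ S₀).base s.pt} = (Set.univ : Set S₀.left) →
        ∀ (α : complexBetti (fiberOver ((baseChangeHom σ).map f₀) s) (2 * p)),
          IsRationalClass α → IsOfHodgeType n (fiberOver ((baseChangeHom σ).map f₀) s) (2 * p) p p α →
          {β : complexBetti (fiberOver ((baseChangeHom σ).map f₀) s) (2 * p) |
              ∃ γ : Path s s, IsContinuationAlong γ α β}.Finite →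
          ∃ (m : ℕ) (W₀ : SchemeOver (AlgebraicClosure ℚ))
            (ι : fiberOver ((baseChangeHom σ).map f₀) s ⟶ (baseChangeHom σ).obj W₀)
            (c' : complexBetti ((baseChangeHom σ).obj W₀) (2 * p)),
            IsSmoothProjective m ((baseChangeHom σ).obj W₀) ∧
            DenseRange (ι.left ≫ baseChangeHomFst σ W₀).base ∧
            IsRationalClass c' ∧ IsOfHodgeType m ((baseChangeHom σ).obj W₀) (2 * p) p p c' ∧
            complexBetti.map ι (2 * p) c' = α := by
  intro hRE hD σ 𝒳₀ S₀ f₀ n p h𝒳₀ hS₀ hirr hsm hf s hgen α hαr hαh hfin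
  haveI := hirr
  -- Step 1 (the orbit): finite orbit ⟹ a finite-index subgroup `H ≤ π₁(S(ℂ), s)` fixes `α`
  obtain ⟨hU, H, hHfi, hHfix⟩ :=
    exists_finiteIndex_of_finite_setOf_isContinuationAlong_of_qbarFamily σ f₀ (2 * p) hS₀ hsm hf
      s α hfin
  -- Step 2 (the finite étale cover `S' → S`, defined over `ℚ̄`): Riemann existence + descent
  obtain ⟨S₀', g₀, s', hs, hS₀'qp, hS'irr, hg₀, hg₀fin, hloops⟩ := hRE σ S₀ hS₀ hirr hsm s H hHfi
  subst hs
  -- Step 3: the bases `S = S₀ ⊗ ℂ`, `S' = S₀' ⊗ ℂ` are smooth of the same pure dimension `d`,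
  -- quasi-projective; `S'(ℂ)` is a connected manifold; `g(ℂ)` is a local homeomorphism
  haveI := hsm
  obtain ⟨d, hd⟩ := Motives.exists_smoothOfRelativeDimension_of_smooth S₀.hom
  haveI := hd
  haveI hSd : SmoothOfRelativeDimension d ((baseChangeHom σ).obj S₀).hom :=
    smoothOfRelativeDimension_baseChangeHom_hom σ d S₀
  have hSqp : IsQuasiProjectiveOver ((baseChangeHom σ).obj S₀) := hS₀.baseChangeHom σ
  have hS'qp : IsQuasiProjectiveOver ((baseChangeHom σ).obj S₀') := hS₀'qp.baseChangeHom σ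
  haveI : LocallyOfFiniteType ((baseChangeHom σ).obj S₀).hom := hSqp.locallyOfFiniteType
  haveI : LocallyOfFiniteType ((baseChangeHom σ).obj S₀').hom := hS'qp.locallyOfFiniteType
  haveI : IsSeparated ((baseChangeHom σ).obj S₀).hom := hSqp.isVarietyPair_ofScheme.isSeparated
  haveI := hg₀
  haveI := hg₀fin
  haveI hg0 : SmoothOfRelativeDimension 0 ((baseChangeHom σ).map g₀).left := by
    letI := σ.toAlgebra
    have := smoothOfRelativeDimension_isStableUnderBaseChange 0
    exact MorphismProperty.of_isPullback (P := @SmoothOfRelativeDimension 0)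
      (Motives.isPullback_baseChange_map_left ℂ g₀).flip inferInstance
  haveI : AlgebraicGeometry.Smooth ((baseChangeHom σ).map g₀).left :=
    SmoothOfRelativeDimension.smooth 0 _
  haveI hS'd : SmoothOfRelativeDimension d ((baseChangeHom σ).obj S₀').hom := by
    have h : SmoothOfRelativeDimension (0 + d)
        (((baseChangeHom σ).map g₀).left ≫ ((baseChangeHom σ).obj S₀).hom) :=
      inferInstance
    rw [Over.w] at h
    simpa using h
  haveI : IrreducibleSpace ((baseChangeHom σ).obj S₀').left := hS'irr
  haveI : ConnectedSpace (ComplexPoints ((baseChangeHom σ).obj S₀')) :=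
    (Motives.ComplexPoints.connectedSpace_iff_holds _).2 inferInstance
  haveI : PathConnectedSpace (ComplexPoints ((baseChangeHom σ).obj S₀')) :=
    pathConnectedSpace_complexPoints_of_smoothOfRelativeDimension _ d
  letI := Motives.ComplexPoints.chartedSpace ((baseChangeHom σ).obj S₀') d
  haveI : LocallyPathConnectedSpace (ComplexPoints ((baseChangeHom σ).obj S₀')) :=
    ChartedSpace.locallyPathConnectedSpace (EuclideanSpace ℝ (Fin (2 * d))) _
  have hgloc : IsLocalHomeomorph (AlgPoints.map ((baseChangeHom σ).map g₀) :
      ComplexPoints ((baseChangeHom σ).obj S₀') → ComplexPoints ((baseChangeHom σ).obj S₀)) :=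
    Motives.ComplexPoints.isLocalHomeomorph_map d _
  -- Step 4 (base change of the family): `f' : 𝒳 ×_S S' ⟶ S'` is smooth projective, `R^{2p} f'_* ℂ`
  -- is a local system, and `α' = e^* α` is monodromy invariant, hence a continuous global section
  have hf' := hf.familyPullback_snd ((baseChangeHom σ).map g₀)
  have hU' := isCohomologicallyLocallyTrivialOn_univ_of_isSmoothProjectiveFamily
    (familyPullback.snd ((baseChangeHom σ).map f₀) ((baseChangeHom σ).map g₀)) d hf' hS'qp
  set e := fiberOverFamilyPullbackIso ((baseChangeHom σ).map f₀) ((baseChangeHom σ).map g₀) s'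
    with he
  have hinv : ∀ γ' : Path (⟨s', Set.mem_univ s'⟩ :
      (Set.univ : Set (ComplexPoints ((baseChangeHom σ).obj S₀')))) ⟨s', Set.mem_univ s'⟩,
      transportFun ((baseChangeHom σ).map f₀) (2 * p) hU
        (s := ⟨AlgPoints.map ((baseChangeHom σ).map g₀) s', Set.mem_univ _⟩)
        (t := ⟨AlgPoints.map ((baseChangeHom σ).map g₀) s', Set.mem_univ _⟩)
        ⟦γ'.map ((((AlgPoints.continuous_map ((baseChangeHom σ).map g₀)).comp
          continuous_subtype_val)).subtype_mk fun _ ↦ Set.mem_univ _)⟧ α = α :=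
    fun γ' ↦ hHfix _ (hloops γ')
  obtain ⟨σ', hσ'c, hσ'pt, hσ'₀⟩ := exists_continuous_section_familyPullback
    ((baseChangeHom σ).map f₀) ((baseChangeHom σ).map g₀) (2 * p) hgloc hU hU' s'
    (complexBetti.map e.hom (2 * p) α) (FiberClass.cls_baseChange_map_hom _ _ _ s' α) hinv
  have h₀ : σ' s' ∈ locusOfHodgeClasses
      (familyPullback.snd ((baseChangeHom σ).map f₀) ((baseChangeHom σ).map g₀)) n p := by
    rw [hσ'₀]
    exact ⟨hαr.map _, hαh.map_of_iso e⟩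
  -- Step 5 (a smooth projective compactification DEFINED OVER `ℚ̄`, kept explicit): the `ℚ̄`-scheme
  -- `X₀' = 𝒳₀ ×_{S₀} S₀'` is quasi-projective, smooth, irreducible of some pure dimension `m`, hence
  -- an open subscheme `i₀ : X₀' ↪ X̄₀` of a smooth projective `X̄₀` (Hironaka, proved), and
  -- `𝒳 ×_S S' ≅ X₀' ⊗_σ ℂ` compatibly with the projections
  set X₀' : SchemeOver (AlgebraicClosure ℚ) := familyPullback f₀ g₀ with hX₀'
  haveI : IsSeparated S₀.hom := isSeparated_hom_of_isQuasiProjectiveOver hS₀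
  have hX₀'qp : IsQuasiProjectiveOver X₀' :=
    isQuasiProjectiveOver_familyPullback_of_isSeparated f₀ g₀ h𝒳₀ hS₀'qp
  haveI : AlgebraicGeometry.Smooth ((baseChangeHom σ).map f₀).left := hf.smooth
  haveI : AlgebraicGeometry.Smooth f₀.left := smooth_of_smooth_baseChangeHom_map_left σ f₀
  haveI : AlgebraicGeometry.Smooth 𝒳₀.hom := by
    rw [← Over.w f₀]
    infer_instance
  haveI : AlgebraicGeometry.Smooth X₀'.hom := by
    change AlgebraicGeometry.Smooth (pullback.fst f₀.left g₀.left ≫ 𝒳₀.hom)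
    infer_instance
  haveI : IrreducibleSpace
      (familyPullback ((baseChangeHom σ).map f₀) ((baseChangeHom σ).map g₀)).left :=
    irreducibleSpace_of_isSmoothProjectiveFamily _ hf'
  obtain ⟨eXP, -, heXP⟩ := exists_familyPullback_iso_baseChangeHom_obj σ f₀ g₀
  set eXP' : (familyPullback ((baseChangeHom σ).map f₀) ((baseChangeHom σ).map g₀)).left ≅
      ((baseChangeHom σ).obj X₀').left := (Over.forget _).mapIso eXP with heXP'
  haveI : IrreducibleSpace ((baseChangeHom σ).obj X₀').left :=
    (Scheme.homeoOfIso eXP').surjective.irreducibleSpace (Scheme.homeoOfIso eXP').continuous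
  haveI : IrreducibleSpace X₀'.left := irreducibleSpace_of_irreducibleSpace_baseChangeHom_obj σ X₀'
  obtain ⟨m, hm⟩ := exists_smoothOfRelativeDimension_of_smooth X₀'.hom
  obtain ⟨Xbar₀, i₀, hXbar₀, hi₀⟩ :=
    exists_isSmoothProjective_isOpenImmersion m X₀' hm hX₀'qp inferInstance
  haveI := hi₀
  have hXbar : IsSmoothProjective m ((baseChangeHom σ).obj Xbar₀) :=
    IsSmoothProjective.baseChangeHom_holds σ hXbar₀
  set i : familyPullback ((baseChangeHom σ).map f₀) ((baseChangeHom σ).map g₀) ⟶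
      (baseChangeHom σ).obj Xbar₀ := eXP.hom ≫ (baseChangeHom σ).map i₀ with hi_def
  haveI hi : IsOpenImmersion i.left := by
    haveI := isOpenImmersion_baseChangeHom_map_left σ i₀
    haveI : IsOpenImmersion eXP.hom.left :=
      (inferInstance : IsOpenImmersion ((Over.forget _).mapIso eXP).hom)
    rw [hi_def, Over.comp_left]
    infer_instance
  -- Step 6 (global invariant cycles + Hodge lift): a rational `(p,p)` class `β` on `X̄₀ ⊗_σ ℂ`
  -- with `β|_{X'_{s'}} = α' = e^* α`
  obtain ⟨β, hβr, hβh, hβσ⟩ :=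
    hD.exists_hodgeClass_eq_globalSection_of_exists_isReal_hodgeModel exists_isReal_hodgeModel_holds
      hodgePQ_independent_of_hodgeModel_holds smoothProjective_hodgeStructure_isPolarizable_holds _ i
      hf' hS'qp (SmoothOfRelativeDimension.smooth d _) hXbar hi hσ'c hσ'pt h₀
  have hα'eq : complexBetti.map e.hom (2 * p) α =
      complexBetti.map (fiberι (familyPullback.snd ((baseChangeHom σ).map f₀)
        ((baseChangeHom σ).map g₀)) s' ≫ i) (2 * p) β := by
    have h1 := hσ'₀.symm.trans hβσ
    rw [(FiberClass.mk_eq_mk_iff _ _).1 h1]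
    simp only [hi_def, complexBetti.map_comp, ModuleCat.comp_apply]
  -- Step 7 (the envelope): `ι = e⁻¹ ≫ (X'_{s'} ⟶ 𝒳 ×_S S') ≫ i`, `c' = β`
  refine ⟨m, Xbar₀,
    e.inv ≫ fiberι (familyPullback.snd ((baseChangeHom σ).map f₀) ((baseChangeHom σ).map g₀)) s' ≫ i,
    β, hXbar, ?_, hβr, hβh, ?_⟩
  · -- DOMINANCE of `𝒳_s ⟶ X̄₀ ⊗_σ ℂ ⟶ X̄₀`
    -- (a) the point `η'` of `S₀'` under `s'` is the generic point of `S₀'`: it lies over the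
    -- generic point of `S₀` and `g₀` is finite
    haveI : IrreducibleSpace S₀'.left := irreducibleSpace_of_irreducibleSpace_baseChangeHom_obj σ S₀'
    have hη' : closure {(baseChangeHomFst σ S₀').base s'.pt} = (Set.univ : Set S₀'.left) := by
      refine closure_singleton_eq_univ_of_locallyQuasiFinite g₀.left ?_
      have heq : g₀.left.base ((baseChangeHomFst σ S₀').base s'.pt) =
          (baseChangeHomFst σ S₀).base (AlgPoints.map ((baseChangeHom σ).map g₀) s').pt := by
        rw [AlgPoints.pt_map]
        change (baseChangeHomFst σ S₀' ≫ g₀.left).base s'.pt =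
          (((baseChangeHom σ).map g₀).left ≫ baseChangeHomFst σ S₀).base s'.pt
        rw [baseChangeHom_map_left_comp_fst]
      rw [heq]
      exact hgen
    -- (b) the generic fibre `A = f₀'⁻¹{η'}` of `f₀' : X₀' ⟶ S₀'` is dense in `X₀'` (`f₀'` is flat)
    haveI : Flat (familyPullback.snd f₀ g₀).left := by
      change Flat (pullback.snd f₀.left g₀.left)
      exact MorphismProperty.pullback_snd (P := @Flat) _ _ inferInstance
    have hA : Dense ((familyPullback.snd f₀ g₀).left.base ⁻¹'
        {(baseChangeHomFst σ S₀').base s'.pt}) :=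
      dense_preimage_singleton_of_flat _ hη'
    -- (c) every point `x₀` of `A` is hit by `X'_{s'} ⟶ 𝒳 ×_S S' ≅ X₀' ⊗ ℂ ⟶ X₀'` (two cartesian
    -- squares), hence `i₀ x₀` is hit by the envelope map
    have key : ∀ x₀ : X₀'.left,
        (familyPullback.snd f₀ g₀).left.base x₀ = (baseChangeHomFst σ S₀').base s'.pt →
        ∃ z : (fiberOver (familyPullback.snd ((baseChangeHom σ).map f₀)
            ((baseChangeHom σ).map g₀)) s').left,
          ((fiberι (familyPullback.snd ((baseChangeHom σ).map f₀) ((baseChangeHom σ).map g₀)) s' ≫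
              i).left ≫ baseChangeHomFst σ Xbar₀).base z = i₀.left.base x₀ := by
      intro x₀ hx₀
      have hsq : IsPullback ((baseChangeHom σ).map (familyPullback.snd f₀ g₀)).left
          (baseChangeHomFst σ X₀') (baseChangeHomFst σ S₀') (familyPullback.snd f₀ g₀).left := by
        letI := σ.toAlgebra
        exact Motives.isPullback_baseChange_map_left ℂ (familyPullback.snd f₀ g₀)
      obtain ⟨pnt, hp1, hp2⟩ :=
        Scheme.exists_preimage_of_isPullback hsq s'.pt x₀ hx₀.symm
      have hcomp : eXP.inv ≫ familyPullback.snd ((baseChangeHom σ).map f₀) ((baseChangeHom σ).map g₀) =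
          (baseChangeHom σ).map (familyPullback.snd f₀ g₀) := by
        rw [← heXP, Iso.inv_hom_id_assoc]
      have hy' : (familyPullback.snd ((baseChangeHom σ).map f₀) ((baseChangeHom σ).map g₀)).left.base
          (eXP.inv.left.base pnt) = s'.pt := by
        change (eXP.inv ≫ familyPullback.snd ((baseChangeHom σ).map f₀)
          ((baseChangeHom σ).map g₀)).left.base pnt = s'.pt
        rw [hcomp]
        exact hp1
      obtain ⟨z, hz⟩ : eXP.inv.left.base pnt ∈ Set.range (fiberι (familyPullback.snd
          ((baseChangeHom σ).map f₀) ((baseChangeHom σ).map g₀)) s').left.base := by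
        rw [range_fiberι_left_base]
        exact hy'
      refine ⟨z, ?_⟩
      have hnat : ((baseChangeHom σ).map i₀).left ≫ baseChangeHomFst σ Xbar₀ =
          baseChangeHomFst σ X₀' ≫ i₀.left := baseChangeHom_map_left_comp_fst σ i₀
      have hhi : eXP.hom.left.base (eXP.inv.left.base pnt) = pnt := by
        change (eXP.inv ≫ eXP.hom).left.base pnt = pnt
        rw [Iso.inv_hom_id]
        rfl
      calc ((fiberι (familyPullback.snd ((baseChangeHom σ).map f₀) ((baseChangeHom σ).map g₀)) s' ≫
              i).left ≫ baseChangeHomFst σ Xbar₀).base z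
          = (((baseChangeHom σ).map i₀).left ≫ baseChangeHomFst σ Xbar₀).base
              (eXP.hom.left.base ((fiberι (familyPullback.snd ((baseChangeHom σ).map f₀)
                ((baseChangeHom σ).map g₀)) s').left.base z)) := rfl
        _ = (baseChangeHomFst σ X₀' ≫ i₀.left).base
              (eXP.hom.left.base ((fiberι (familyPullback.snd ((baseChangeHom σ).map f₀)
                ((baseChangeHom σ).map g₀)) s').left.base z)) := by rw [hnat]
        _ = i₀.left.base x₀ := by
              rw [hz, hhi]
              change i₀.left.base ((baseChangeHomFst σ X₀').base pnt) = _
              rw [hp2]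
    -- (d) `i₀(A)` is dense in the irreducible `X̄₀` and contained in the range
    have hsub : i₀.left.base '' ((familyPullback.snd f₀ g₀).left.base ⁻¹'
        {(baseChangeHomFst σ S₀').base s'.pt}) ⊆
        Set.range ((fiberι (familyPullback.snd ((baseChangeHom σ).map f₀)
          ((baseChangeHom σ).map g₀)) s' ≫ i).left ≫ baseChangeHomFst σ Xbar₀).base := by
      rintro _ ⟨x₀, hx₀, rfl⟩
      exact key x₀ hx₀
    haveI : IrreducibleSpace Xbar₀.left :=
      haveI := hXbar₀.geometricallyIrreducible
      GeometricallyIrreducible.irreducibleSpace_of_subsingleton Xbar₀.hom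
    obtain ⟨x₁⟩ := (inferInstance : Nonempty X₀'.left)
    have hi₀dense : DenseRange i₀.left.base :=
      i₀.left.isOpenEmbedding.isOpen_range.dense ⟨_, ⟨x₁, rfl⟩⟩
    have hG : Dense (Set.range ((fiberι (familyPullback.snd ((baseChangeHom σ).map f₀)
        ((baseChangeHom σ).map g₀)) s' ≫ i).left ≫ baseChangeHomFst σ Xbar₀).base) :=
      (hi₀dense.dense_image i₀.left.continuous hA).mono hsub
    -- (e) precompose with the isomorphism `e⁻¹ : 𝒳_s ≅ X'_{s'}` (surjective on points)
    have hsurj : Function.Surjective e.inv.left.base := e.inv.left.surjective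
    have hF : ((((e.inv ≫ fiberι (familyPullback.snd ((baseChangeHom σ).map f₀)
        ((baseChangeHom σ).map g₀)) s' ≫ i).left ≫ baseChangeHomFst σ Xbar₀).base : _ → _)) =
        ((fiberι (familyPullback.snd ((baseChangeHom σ).map f₀) ((baseChangeHom σ).map g₀)) s' ≫
          i).left ≫ baseChangeHomFst σ Xbar₀).base ∘ e.inv.left.base := rfl
    rw [DenseRange, hF, hsurj.range_comp]
    exact hG
  · rw [complexBetti.map_comp, ModuleCat.comp_apply, ← hα'eq]
    exact e.symm.complexBetti_map_hom_map_inv (2 * p) α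

end Summit.HodgeConjecture.HodgeConjecture.Theorems

end
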